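import Literature.NumberTheory.K2Lit.DoubledUnitaryDegeneratePrincipalSeries
import Literature.NumberTheory.GelbartRogawski1991.LocalSplittingCMParabolicEigenfunctional
import Literature.NumberTheory.GaloisRepresentations.HeckeCharacter
import Summits.HodgeConjecture.HodgeConjecture.Theorems.K2LiuSiegelWeilScalarEqCharacter
import Summits.HodgeConjecture.HodgeConjecture.Theorems.K2LiuLocalSiegelCharacterMul
import Summits.HodgeConjecture.HodgeConjecture.Theorems.K2LiuSiegelWeilSectionMem               -- ★ p854863 (K2Liu-p02): #7b PAID, tied ED. 4
import HarnessLib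

/-!
# K2_Liu_CurveThetaSigs — unit U3c «LOCAL SIEGEL» (build stream 29, Track B, tier 1; info-only sockets)

Planner `hodgecm-mathlib-K2Liu-plan` (g0), 2026-09-03. Third socket module under the SIG TABLE
`Cruxes/HLiu418/Lines/K2_Liu_CurveThetaSigs.md`; conventions as in U1 ∕ U3a ∕ U3b: every `theorem sig_K2Liu<Name>` is a SOCKET —
statement = the exact bytes a prover's `Theorems/K2Liu<Name>.lean` must prove, body `sorry`; NOT a registered skeleton, NO
`<Crux>_of`; `import`s = the tree leaves the statements are typed over (★ `K2Lit/DoubledUnitaryDegeneratePrincipalSeries` = DEFS leaf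
D1, p854713). ED. 4 (2026-09-03 ≈22:00Z): #7b TIED BY NAME to ★ p854863 `Theorems/K2LiuSiegelWeilSectionMem` (K2Liu-p02) — the module now carries NO `sorry`:
all three local Siegel sockets #7a #7b #7c are ★.
HONEST LABEL: HC_CM is proved only modulo the 7 printed citations (2 remaining named inputs: hLiu418 =
stmt-HodgeConjecture-24832, h413 = stmt-HodgeConjecture-24833) until rung 0 closes; sockets close nothing.

Unit U3c = the local Siegel-parabolic bookkeeping of [Liu2021, §B.3 p. 101] ∕ [HarrisKudlaSweet1996, §1 (1.15)–(1.16)] that the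
Siegel–Weil-section socket #7 («`h ↦ ω_v(h)Φ(0)` lies in `I_v(s₁, χ_v)`») is assembled from:

* #7a `sig_K2LiuSiegelWeilScalarEqCharacter` (S) — NORMALISATION BRIDGE: the eigen-scalar of the tree's Kudla–Weil eigen-law ★
  `apply_zero_toRep_mul_localSplitting_eq_mul` (`(χ_v⁻¹(det_Δ p))⁻¹ · ∏_{w∣v} ‖det_Δ p_w‖^{1∕2}`, [HarrisKudlaSweet1996 §1 (1.16)]: `|det a|^{m∕2}`,
  partner dimension `m = 1`) IS the inducing character `localSiegelCharacter χ_v s₁` of D1 at `s₁ = (1 − n)∕2` (`s₁ + n∕2 = ½`). Pure algebra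
  (`(χ⁻¹)⁻¹ = χ` factorwise in ★ `chiDet`; `∏ √‖a_w‖ = (∏ ‖a_w‖)^{1∕2}` as a complex power of a non-negative real). It pins D1's
  exponent convention against the tree — if D1 were mis-normalised this socket would be unprovable, so it is also the leaf's falsifier.
* #7c `sig_K2LiuLocalSiegelCharacterMul` (S–M) — `localSiegelCharacter χ_v s` is multiplicative on `P_Δ(F_v)` (local twin of ★ global
  `GRConstruction.detDelta_mul ∕ chiDet_mul ∕ modDelta_mul`: `det_Δ(pq)_w = det_Δ(p)_w · det_Δ(q)_w` for `p, q ∈ P_Δ`); needed for `I_v(s, χ_v) ≠ 0`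
  consistency and for the intertwining ∕ restricted-tensor-product files.
The membership socket #7b (eigen-law ★ + #7a + smoothness ★ `isLocallyConstant_toRep_localSplitting_comp` ⇒ `(h ↦ ω_v(h)Φ(0)) ∈ localDegPS χ_v s₁`)
is typed over the ★ CM Weil-datum telescope (`localSplittingDatumCM L v μ n hT₀ hT₀d rfl χ hχ`, implementer `m₀`, `w₀`) in the next edition.
-/

namespace Summit.HodgeConjecture.HodgeConjecture.Cruxes.HLiu418.K2LiuCurveThetaSigsU3cLocalSiegel

open NumberField IsDedekindDomain MeasureTheory
open Literature.NumberTheory.Automorphic Literature.NumberTheory.Automorphic.UnitaryGroup Literature.NumberTheory.Weil1964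
open Literature.RepresentationTheory.HeisenbergGroup Literature.RepresentationTheory.HarrisKudlaSweet1996
open Literature.NumberTheory.GaloisRepresentations
open Literature.NumberTheory.GelbartRogawski1991.UnitaryDualPair.LocalSplitting
open Literature.NumberTheory.K2Lit.LocalSiegelDoubled
open Literature.NumberTheory.GelbartRogawski1991.UnitaryDualPair (complexConj_imagUnit imagUnit_ne_zero imagUnit_mul_self)

/-- SOCKET #7a (U3c «LOCAL SIEGEL», size S; deps ★ `LocalDoubledUnitaryDatum.chiDet ∕ detDelta`, ★ D1 `localSiegelCharacter ∕ absDetDelta`,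
★ `HeckeCharacter.localComponent`; junction: none; OWNER K2Liu).
**Normalisation bridge.** For a CM field `L ⊃ L⁺`, a finite place `v` of `L⁺`, any `n`, any doubled Gram matrix `J^𝔻`, a Hecke character `χ` of `L`
and ANY `p ∈ H(L⁺_v)`: the Kudla–Weil eigen-scalar of ★ `apply_zero_toRep_mul_localSplitting_eq_mul`, namely
`(χ_v⁻¹(det_Δ p))⁻¹ · ∏_{w ∣ v} ‖det_Δ p_w‖^{1∕2}`, equals `localSiegelCharacter χ_v s₁ p = χ_v(det_Δ p) · |det_Δ p|_v^{s₁ + n∕2}` at `s₁ = (1 − n)∕2`.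
So the Siegel–Weil section `h ↦ ω_v(h)Φ(0)` of the pair (`U(𝕍), U(W₁)`), `dim W₁ = 1`, is a section of `I_v((1 − n)∕2, χ_v)` in D1's (unitary)
normalisation — for `n = 2` (Liu's `J_0(s, ·)` on `U(2,2)`): `s₁ = −½`.
audit: [HarrisKudlaSweet1996 §1 (1.16)] «ω(m(a))φ(x) = χ(det a)|det a|^{m∕2} φ(xa)»; [Liu2021 §B.3 p. 101] «the normalized induced representation»;
★ eigen-law scalar read off `LocalSplittingCMParabolicEigenfunctional.lean` :119–:122 verbatim.
[cite: HarrisKudlaSweet1996, §1 (1.16)] [cite: Liu2021, §B.3 p. 101] [cite: Kudla1994, §3 Thm. 3.1] -/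
theorem sig_K2LiuSiegelWeilScalarEqCharacter : ∀ (L : Type) [Field L] [NumberField L] [IsCMField L]
    (v : HeightOneSpectrum (𝓞 (maximalRealSubfield L))) (n : ℕ) {JD : Matrix (Fin (n + n)) (Fin (n + n)) L}
    (χ : HeckeCharacter L) (p : UnitaryGroup.localPi L (IsCMField.complexConj L) (n + n) JD v),
    (((chiDet (maximalRealSubfield L) L (IsCMField.complexConj L) v n
          (fun w' : PlacesOver L v => (χ.localComponent w'.1)⁻¹) p)⁻¹ : ℂˣ) : ℂ) *
        ((∏ w' : PlacesOver L v,
          Real.sqrt ‖detDelta (maximalRealSubfield L) L (IsCMField.complexConj L) v n w' p‖ : ℝ) : ℂ) =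
      localSiegelCharacter (maximalRealSubfield L) L (IsCMField.complexConj L) v n
        (fun w' : PlacesOver L v => χ.localComponent w'.1) ((1 - (n : ℂ)) / 2) p :=
  Summit.HodgeConjecture.HodgeConjecture.Cruxes.HLiu418.K2LiuSiegelWeilScalarEqCharacter.siegelWeilScalarEqCharacter -- ★ PAID p854752 (K2Liu-p07), tied ED. 3

/-- SOCKET #7c (U3c «LOCAL SIEGEL», size S–M; deps ★ `LocalDoubledUnitaryDatum.IsSiegelDelta ∕ detDelta ∕ chiDet ∕ deltaBlock`, ★ D1
`localSiegelCharacter`; pattern: ★ global `DoubledUnitarySiegelParabolicAlgebra.detDelta_mul ∕ chiDet_mul ∕ modDelta_mul`; junction: none; OWNER K2Liu).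
**The inducing character is multiplicative on `P_Δ(F_v)`.** General quadratic `E∕F`, `c`, `δ`, finite `v`, symmetric `T₀`, `J^𝔻 = (T₀ ⊕ −T₀) ⊗ 1`:
for `p, q ∈ P_Δ(F_v)` (★ `IsSiegelDelta`) and every family `χ_w : E_wˣ →* ℂˣ`, `s ∈ ℂ`:
`localSiegelCharacter χ_v s (p q) = localSiegelCharacter χ_v s p · localSiegelCharacter χ_v s q` — from `det_Δ(pq)_w = det_Δ(p)_w det_Δ(q)_w`
(the `Δ`-block of a product of two stabilisers of `Δ`) and `IsUnit (det_Δ p_w)` on `P_Δ`.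
audit: [HarrisKudlaSweet1996 §1 (1.15)] «χ(x(p₁p₂)) = χ(x(p₁))χ(x(p₂))»; ★ global twin `GRConstruction.detDelta_mul` (:184) is the proof pattern.
[cite: HarrisKudlaSweet1996, §1 (1.15)] [cite: Kudla1994, §3] -/
theorem sig_K2LiuLocalSiegelCharacterMul : ∀ (F : Type) [Field F] [NumberField F] (E : Type) [Field E] [NumberField E] [Algebra F E]
    [Algebra.IsQuadraticExtension F E] (c : E ≃ₐ[F] E) {δ : E} (hcδ : c δ = -δ) (hδ : δ ≠ 0) {d : F} (hd : δ * δ = algebraMap F E d)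
    (v : HeightOneSpectrum (𝓞 F)) (n : ℕ) {T₀ : Matrix (Fin n) (Fin n) F} (hT₀ : T₀.IsSymm)
    {JD : Matrix (Fin (n + n)) (Fin (n + n)) E} (hJD : JD = (gramD F n T₀).map (algebraMap F E))
    (χv : ∀ w : UnitaryGroup.PlacesOver E v, (w.1.adicCompletion E)ˣ →* ℂˣ) (s : ℂ)
    (p q : UnitaryGroup.localPi E c (n + n) JD v),
    IsSiegelDelta F E c hcδ hδ hd v n hT₀ hJD p → IsSiegelDelta F E c hcδ hδ hd v n hT₀ hJD q →
      localSiegelCharacter F E c v n χv s (p * q) =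
        localSiegelCharacter F E c v n χv s p * localSiegelCharacter F E c v n χv s q :=
  Summit.HodgeConjecture.HodgeConjecture.Cruxes.HLiu418.K2LiuLocalSiegelCharacterMul -- ★ PAID p854813 (K2Liu-p04), tied ED. 3


set_option maxHeartbeats 4000000 in -- the doubled CM datum's telescope (as in ★ `LocalSplittingCMParabolicEigenfunctional`)
/-- SOCKET #7b (U3c «LOCAL SIEGEL», ED. 2; ★ PAID p854863 (K2Liu-p02) `Theorems/K2LiuSiegelWeilSectionMem.siegelWeilSectionMem`, statement BYTE-IDENTICAL,
TIED BY NAME in ED. 4; size S–M; deps ★ `LocalSplittingCMParabolicEigenfunctional.apply_zero_toRep_mul_localSplitting_eq_mul`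
(the eigen-law of `λ′ = ev₀ ∘ ω^𝔻(m₀ · s^𝔻 w₀)` on `w₀`-conjugate Siegel elements), ★ D1 `localDegPS ∕ IsLocalSiegelSection ∕ IsSmooth`
(p854713), socket #7a `sig_K2LiuSiegelWeilScalarEqCharacter` (the eigen-scalar IS `localSiegelCharacter χ_v ((1 − n)∕2)`), ★
`LocalDoubledTwistedSectionEigenlaw.isLocallyConstant_toRep_localSplitting_comp` ∕ open stabilisers of Schwartz–Bruhat vectors (smoothness);
junction: none (pure local statement); OWNER K2Liu; organ O2 of the LEAD's ADDENDUM v1.1 (Siegel–Weil sections), also the partner LINE's input) —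
**the local Siegel–Weil section lies in the degenerate principal series at `s₁ = (1 − n)∕2`**: for the CM Weil datum of record at a finite place `v`
of `L⁺` (doubled space `𝔻 = D ⊕ −D` of rank `n + n`, partner of rank `m = 1`, splitting character `χ`), a metaplectic `m₀` moving the Lagrangian
`Δ` to `Y` and an involution `w₀` of `H(L⁺_v)`, the function
`F_Φ(h) = (ω^𝔻(m₀ s^𝔻(w₀)) ω^𝔻(s^𝔻(w₀ h w₀)) Φ)(0)` satisfies `F_Φ(p h) = χ_v(det_Δ p)|det_Δ p|^{1∕2} F_Φ(h)` for `p ∈ P_Δ(L⁺_v)`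
(eigen-law at `p′ = w₀ p w₀` + #7a) and is right-invariant under the open subgroup `w₀ · Stab(Φ) · w₀`, i.e.
`F_Φ ∈ I_v((1 − n)∕2, χ_v) =` ★ `localDegPS … (fun w′ ↦ χ.localComponent w′) ((1 − n)∕2)`.
Why it might fail: only by a convention slip — the eigen-law is stated for `χ⁻¹`-components inside ★ `chiDet` and #7a converts; if #7a turned out
false by a conjugate∕inverse flip (referee (B2′) item 1), this socket inherits the one-token repair (`χ` ↦ `χ⁻¹` in the target `χv`).
[cite: Kudla1994, §3 Thm. 3.1] [cite: HarrisKudlaSweet1996, §1 (1.16)–(1.17) (WANT acq-04821)] [cite: Liu2021, §B.3 p. 101]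
audit: paper:liu2021-fourier-jacobi-cycles-arithmetic-relative-trace-formula p0101.txt:L29 «IndPa (Aa F ) F (μc · | |s ) ◦ detn+a» -/
theorem sig_K2LiuSiegelWeilSectionMem :
    ∀ (L : Type) [Field L] [NumberField L] [IsCMField L] (v : HeightOneSpectrum (𝓞 (maximalRealSubfield L)))
      [MeasurableSpace (v.adicCompletion (maximalRealSubfield L))] [BorelSpace (v.adicCompletion (maximalRealSubfield L))]
      (μ : Measure (v.adicCompletion (maximalRealSubfield L))) [μ.IsAddHaarMeasure]
      (n : ℕ) {T₀ : Matrix (Fin n) (Fin n) (maximalRealSubfield L)} (hT₀ : T₀.IsSymm) (hT₀d : IsUnit T₀.det)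
      (χ : HeckeCharacter L) (hχ : IsSplittingChar L 1 χ)
      (m₀ : LocalMp (maximalRealSubfield L) (n + n) (gramD (maximalRealSubfield L) n T₀) v)
      (_hm₀ : (deltaLagrangian (maximalRealSubfield L) v n).map (toLin (maximalRealSubfield L) v (MpPsi.proj _ m₀)) =
        lagrangianY (maximalRealSubfield L) (n + n) v)
      (w₀ : UnitaryGroup.localPi L (IsCMField.complexConj L) (n + n)
        ((gramD (maximalRealSubfield L) n T₀).map (algebraMap (maximalRealSubfield L) L)) v)
      (_hw₀ : w₀ * w₀ = 1)
      (Φ : SchwartzBruhat (Fin (n + n) → v.adicCompletion (maximalRealSubfield L))),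
      (fun h : UnitaryGroup.localPi L (IsCMField.complexConj L) (n + n)
          ((gramD (maximalRealSubfield L) n T₀).map (algebraMap (maximalRealSubfield L) L)) v =>
        ((MpPsi.toRep (localSchrodinger (maximalRealSubfield L) (n + n) (gramD (maximalRealSubfield L) n T₀) v)
              (m₀ * (localSplittingDatumCM L v μ n hT₀ hT₀d rfl χ hχ).localSplitting w₀)
              (MpPsi.toRep (localSchrodinger (maximalRealSubfield L) (n + n) (gramD (maximalRealSubfield L) n T₀) v)
                ((localSplittingDatumCM L v μ n hT₀ hT₀d rfl χ hχ).localSplitting (w₀ * h * w₀)) Φ) :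
            SchwartzBruhat (Fin (n + n) → v.adicCompletion (maximalRealSubfield L))) :
            (Fin (n + n) → v.adicCompletion (maximalRealSubfield L)) → ℂ) 0)
        ∈ localDegPS (maximalRealSubfield L) L (IsCMField.complexConj L) (complexConj_imagUnit L) (imagUnit_ne_zero L)
            (imagUnit_mul_self L) v n hT₀ rfl (fun w' : PlacesOver L v => χ.localComponent w'.1) ((1 - (n : ℂ)) / 2) :=
  Summit.HodgeConjecture.HodgeConjecture.Cruxes.HLiu418.K2LiuSiegelWeilSectionMem.siegelWeilSectionMem -- ★ PAID p854863 (K2Liu-p02), tied ED. 4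

end Summit.HodgeConjecture.HodgeConjecture.Cruxes.HLiu418.K2LiuCurveThetaSigsU3cLocalSiegel
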